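import Summits.ABC.IUTFork.Cor312LicenceTripleHullCellRefute
import Summits.ABC.IUTFork.Cor312GenuineKWildExactTriple
import Summits.ABC.IUTFork.Conditional.RefBandsFrey160412424963707ThreeCells
import HarnessLib

/-!
# R-W «W:REF-BAND-REST» — `7³·29⁵·151² + 2⁴·5¹⁶·97·919 = 3²⁷·13⁴`: the hull-level clause S_H is REFUTED at EVERY genuine Θ-volume datum over `(ratPoint (a/c), l)` for EVERY
# prime `11 ≤ l ≤ 159389`, `l ≠ 3`, UNIFORMLY in `l`, at the EXACT local type `e₀ = 10l` of the pole `p = 3` (kernel class theorem, NOT a hypothesis)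

PROOF-ONLY file (D-0012; 0 definitions, 0 `Prop` facts, no instance, no notation) of the abc-iut cell (branch C certificate seat abc-iut-C-cert-1, gen 8;
row «W:REF-BAND-REST», abc-iut-plan C-R107 (b); target named by abc-iut-W-num-5 g5's engine C, STATUS 2026-08-27T07:49:21Z / 08:25:55Z; generator
HOME/staging/C/cert-1/g8/hexrest/hexgen/gen_refP.py). TAKES NO SIDE on [IUTchIII] Cor. 3.12 (S. Mochizuki, *Inter-universal Teichmüller theory III*, Cor. 3.12
p. 173–174; Step (xi-f) p. 184) or on any author; «refuted as typed» ≠ «refuted in print».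
BEFORE THIS FILE (BY NAME): K-line REF for this triple only at the tabulated levels `l ≤ 27` (R-W rows files; W-num-5: «kernel REF ∀T only to l = 27»); engine C
certifies REF at every axis prime `11 ≤ l ≤ 159,389` (then INH ∀T from `159,403`, W-num-6's inhabited band threshold 159,395 ✓, no prime between).
THIS FILE: at the pole `p = 3` (`v = v_3(abc) = 27`) the local type of EVERY fibre point of every genuine datum is `e₀ = 10l` BY THEOREM (abc-iut-W-neg-1 g3 `GenuineK.absRamificationIdx_kOf_frey160412424963707_three` (`Cor312GenuineKWildExactTriple`: `3 ∣ v = 27`, `9 ∣ D` ⇒ SPLIT, `e = 10·l`));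
`e₀` is prime to `3`, so abc-iut-W-neg-1's explicit-type socket `WRow.not_licence_triple_of_not_hullCell` (`Cor312LicenceTripleHullCellRefute`, p493429: tame different `(e₀−1)/e₀`,
inner radius `⌊e₀/2⌋ + 1`, outer radius at the turning point) applies with `P = e₀·v/l = 270`; per turning-point piece
(a₀ = 4 on 11 ≤ l ≤ 15; a₀ = 5 on 17 ≤ l ≤ 47; a₀ = 6 on 49 ≤ l ≤ 145; a₀ = 7 on 147 ≤ l ≤ 437; a₀ = 8 on 439 ≤ l ≤ 1311; a₀ = 9 on 1313 ≤ l ≤ 3935; a₀ = 10 on 3937 ≤ l ≤ 11809; a₀ = 11 on 11811 ≤ l ≤ 35429; a₀ = 12 on 35431 ≤ l ≤ 106287; a₀ = 13 on 106289 ≤ l ≤ 159391) the top-label `HullCell` FAILS by a floor-free argument, and at the literal prime(s) [] by the exact floor.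
Shapes: `WRow.not_licence_frey160412424963707_three_band` (∀ realising ideles), `WRow.not_exists_qPinned_and_hull_frey160412424963707_three_band` (branch C's antecedent). DESK (two engines agree: this seat's exact
top-label scan and W-num-5 g5's engine C): the exact cell fails at every prime of the band and first holds at `l = 159403`; the inhabited side is NOT claimed here.
HONEST SCOPE: OUR sharp containers and Dupuy–Hilado's typed (Ind1)/(Ind2); the per-label licence is a STRONGER-THAN-PRINT sufficient form of Step (xi-f); admissibility /
Szpiro-badness / (P6) of `(ratPoint (a/c), l)` and NON-EMPTINESS of the datum type are NOT claimed; nothing about the printed inequality, the number-level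
`Cor22.Cor312AtDatum` or any author's intended hull; typed ≠ proved; instantiated ≠ endorsed; no abc claim.
[cite: Mochizuki2012, IUTchI Ex. 3.2 (iv) p. 71; IUTchIII Cor. 3.12 Step (xi-d) p. 183, (xi-f) p. 184; IUTchIV Prop. 1.1 p. 9, Prop. 1.2 (i)(ii) p. 10, Thm. 1.10 p. 22, Cor. 2.2 (ii) proof (P5) p. 46]
[cite: DupuyHilado2025, §3.3, §3.4, §4.9, §4.12] [cite: Serre1972, §1.11–§1.12] [claim: Mochizuki2012, status: disputed] for every IUT sentence quoted.
-/

noncomputable section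

open Set Function NumberField IsDedekindDomain

namespace Summit.ABC.IUTFork.Conditional

open Thm311 Thm311.Real Cor312 Cor312Vol Cor312Prov Literature.IUT.LogThetaLattice Literature.IUT.LogVolume
  Literature.IUT.HodgeTheaters Literature.IUT.LogVolume.ThetaData Literature.IUT.LogVolume.Cor22
open Literature.NumberTheory.NumberFields Literature.NumberTheory.GaloisRepresentations.Ultrametric
open Literature.NumberTheory.DiophantineGeometry Literature.NumberTheory.DiophantineGeometry.GenEll Summit.ABC.ABC.Theorems
open Summit.ABC.IUTFork.Repair.RH.HullThresholdExact

/-! ## §2. The W-lane shapes, every prime `11 ≤ l ≤ 159389`, `l ≠ 3` -/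

/-- Bookkeeping for a prime `11 ≤ l ≤ 159389`, `l ≠ 3`: `l ≤ 159391`, odd, `3 ∤ 10l`, and the top label index is admissible. [folklore] -/
private theorem RefBand.frey160412424963707_three_aux {l : ℕ} (hl : l.Prime) (hlo : 11 ≤ l) (hhi : l ≤ 159389) (hne : l ≠ 3) :
    (l ≤ 159391) ∧ Odd l ∧ ¬ (3 : ℕ) ∣ 10 * l ∧ (l - 1) / 2 - 1 + 1 ≤ (l - 1) / 2 := by
  refine ⟨?_, hl.odd_of_ne_two (by omega), ?_, ?_⟩
  · omega
  · intro h
    rcases (Nat.Prime.dvd_mul (by norm_num : Nat.Prime 3)).mp h with h1 | h1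
    · revert h1; norm_num
    · exact hne (((Nat.prime_dvd_prime_iff_eq (by norm_num : Nat.Prime 3) hl).mp h1).symm)
  · have h3 : 3 ≤ l := by omega
    omega

/-- **`7³·29⁵·151² + 2⁴·5¹⁶·97·919 = 3²⁷·13⁴`, every prime `11 ≤ l ≤ 159389`, `l ≠ 3`: `¬ Thm311ToCor312.Licence (settingPrVolSharp …)` for EVERY pair of realising ideles**
at every genuine datum over `(ratPoint (a/c), l)` — `WRow.not_licence_triple_of_not_hullCell` at `p = 3` with the EXACT local type `e₀ = 10l`
(abc-iut-W-neg-1 g3 `GenuineK.absRamificationIdx_kOf_frey160412424963707_three` (`Cor312GenuineKWildExactTriple`: `3 ∣ v = 27`, `9 ∣ D` ⇒ SPLIT, `e = 10·l`)) and `RefBand.cells_frey160412424963707_three_band`. [cite: Mochizuki2012, IUTchIII Cor. 3.12 Step (xi-f) p. 184] [cite: DupuyHilado2025, §4.9] [claim: Mochizuki2012, status: disputed] -/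
theorem WRow.not_licence_frey160412424963707_three_band {l : ℕ} (hl : l.Prime) (hlo : 11 ≤ l) (hhi : l ≤ 159389) (hne : l ≠ 3)
    (T : Cor22.ThetaVolumeDatumAt (ratPoint (((7 ^ 3 * 29 ^ 5 * 151 ^ 2 : ℕ) : ℚ) / (3 ^ 27 * 13 ^ 4 : ℕ))) l) :
    letI := T.instFieldF; letI := T.instNumberFieldF; letI := T.instAlgebraF; letI := T.instFieldK
    letI := T.instNumberFieldK; letI := T.instAlgebraK; letI := T.instFieldFbar; letI := T.instAlgebraFbar
    letI := T.instAlgebraKFbar; letI := T.instIsElliptic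
    ∀ {logv : PadicLogs T.K} (hlog : LogvAnalytic logv) (M : Type) [Field M] [NumberField M]
      (archPk : ∀ (j : (thetaIndex (pilotDataOfK T.D T.K)).Label) (vQ : (thetaIndex (pilotDataOfK T.D T.K)).VQ),
        Set ((logShellsDH (pilotDataOfK T.D T.K) logv).Packet j vQ))
      (archSub : ∀ (j : (thetaIndex (pilotDataOfK T.D T.K)).Label) (v : (thetaIndex (pilotDataOfK T.D T.K)).V),
        Set ((logShellsDH (pilotDataOfK T.D T.K) logv).Packet j ((thetaIndex (pilotDataOfK T.D T.K)).over v)))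
      (Ψ : ℤ → ∀ v : (thetaIndex (pilotDataOfK T.D T.K)).V, v ∈ (thetaIndex (pilotDataOfK T.D T.K)).Vbad →
        Set ((logShellsDH (pilotDataOfK T.D T.K) logv).StarPacket v))
      (act : ℤ → ∀ v : (thetaIndex (pilotDataOfK T.D T.K)).V, v ∈ (thetaIndex (pilotDataOfK T.D T.K)).Vbad →
        (logShellsDH (pilotDataOfK T.D T.K) logv).StarPacket v → Module.End ℚ ((logShellsDH (pilotDataOfK T.D T.K) logv).StarPacket v))
      (Mmod : ℤ → ∀ j : (thetaIndex (pilotDataOfK T.D T.K)).LabelStar, Set ((logShellsDH (pilotDataOfK T.D T.K) logv).GlobalPacket j.1))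
      (region : ℤ → ∀ j : (thetaIndex (pilotDataOfK T.D T.K)).LabelStar, FinDivisor M → ∀ vQ : (thetaIndex (pilotDataOfK T.D T.K)).VQ,
        Set ((logShellsDH (pilotDataOfK T.D T.K) logv).Packet j.1 vQ))
      (n : ℤ) {HT : Type} {LogLink : HT → HT → Type} {IsFull : ∀ {s t : HT}, LogLink s t → Prop}
      (lat : LGPGaussianLogThetaLattice LogLink IsFull)
      {Frd : Type} {IsoF : Frd → Frd → Type} {Ob : Frd → Type} {realify : Frd → Frd} {Strip : Type}
      {IsoS : Strip → Strip → Type} {Mv : ∀ v : (thetaIndex (pilotDataOfK T.D T.K)).V, v ∈ (thetaIndex (pilotDataOfK T.D T.K)).Vbad → Type}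
      [∀ v h, Monoid (Mv v h)]
      (sig : GlobalLGPFrobenioidSignature (thetaIndex (pilotDataOfK T.D T.K)).lstar (thetaIndex (pilotDataOfK T.D T.K)).V
        (· ∈ (thetaIndex (pilotDataOfK T.D T.K)).Vbad) Frd IsoF Ob realify Strip IsoS Mv)
      (split : SplittingMonoids Mv) {ObΔ : Type} {N : ∀ v : (thetaIndex (pilotDataOfK T.D T.K)).V, v ∈ (thetaIndex (pilotDataOfK T.D T.K)).Vbad → Type}
      [∀ v h, Monoid (N v h)] (qData : QPilotData ObΔ N)
      (tq : ∀ (pp : Nat.Primes) (x : (thetaIndex (pilotDataOfK T.D T.K)).Fibre (.inr pp)),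
        haveI : Fact (pp : ℕ).Prime := ⟨pp.2⟩; kOf (pilotDataOfK T.D T.K) pp.1 x)
      (t : ∀ (pp : Nat.Primes) (_ : Fin (pilotDataOfK T.D T.K).lstar) (x : (thetaIndex (pilotDataOfK T.D T.K)).Fibre (.inr pp)),
        haveI : Fact (pp : ℕ).Prime := ⟨pp.2⟩; kOf (pilotDataOfK T.D T.K) pp.1 x)
      (htq0 : ∀ pp x, tq pp x ≠ 0)
      (htq1 : ∀ (pp : Nat.Primes) (x : (thetaIndex (pilotDataOfK T.D T.K)).Fibre (.inr pp)),
        haveI : Fact (pp : ℕ).Prime := ⟨pp.2⟩; placeOf (pilotDataOfK T.D T.K) pp.1 x ∉ (pilotDataOfK T.D T.K).S → ‖tq pp x‖ = 1)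
      (_ht0 : ∀ pp i x, t pp i x ≠ 0)
      (_ht : ∀ (pp : Nat.Primes) (i : Fin (pilotDataOfK T.D T.K).lstar) (x : (thetaIndex (pilotDataOfK T.D T.K)).Fibre (.inr pp)),
        haveI : Fact (pp : ℕ).Prime := ⟨pp.2⟩
        Real.log ‖t pp i x‖ = -((pilotDataOfK T.D T.K).thetaPilot i (placeOf (pilotDataOfK T.D T.K) pp.1 x)) *
          logNorm T.K (placeOf (pilotDataOfK T.D T.K) pp.1 x) / localDegree T.K (placeOf (pilotDataOfK T.D T.K) pp.1 x))
      (_htq : ∀ (pp : Nat.Primes) (x : (thetaIndex (pilotDataOfK T.D T.K)).Fibre (.inr pp)),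
        haveI : Fact (pp : ℕ).Prime := ⟨pp.2⟩
        Real.log ‖tq pp x‖ = -((pilotDataOfK T.D T.K).qPilot (placeOf (pilotDataOfK T.D T.K) pp.1 x)) *
          logNorm T.K (placeOf (pilotDataOfK T.D T.K) pp.1 x) / localDegree T.K (placeOf (pilotDataOfK T.D T.K) pp.1 x)),
      ¬ Thm311ToCor312.Licence
        (settingPrVolSharp (pilotDataOfK T.D T.K) hlog M archPk archSub Ψ act Mmod region n lat sig split qData tq t htq0 htq1) := by
  obtain ⟨hhi', hodd, hpe, hi⟩ := RefBand.frey160412424963707_three_aux hl hlo hhi hne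
  obtain ⟨a₀, h1, h2, h3⟩ := RefBand.cells_frey160412424963707_three_band hlo hhi' hodd (i := (l - 1) / 2 - 1) (by omega)
  have hP : 10 * l * (7 ^ 3 * 29 ^ 5 * 151 ^ 2 * (2 ^ 4 * 5 ^ 16 * 97 * 919) * (3 ^ 27 * 13 ^ 4)).factorization ((⟨3, by norm_num⟩ : Nat.Primes) : ℕ) = l * 270 := by
    rw [RefBand.frey160412424963707_three_fac]; ring
  intro logv hlog M _ _ archPk archSub Ψ act Mmod region n HT LogLink IsFull lat Frd IsoF Ob realify Strip IsoS Mv _ sig split ObΔ N _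
    qData tq t htq0 htq1 ht0 ht htq
  exact WRow.not_licence_triple_of_not_hullCell isABCTriple_frey160412424963707 T ⟨3, by norm_num⟩ (by norm_num) (show (3 : ℕ) ≠ l by omega)
    (by norm_num) (e₀ := 10 * l) (P := 270) (i := (l - 1) / 2 - 1) (a₀ := a₀) hpe (GenuineK.absRamificationIdx_kOf_frey160412424963707_three T (by omega)) hP hi h1 h2 h3
    hlog M archPk archSub Ψ act Mmod region n lat sig split qData tq t htq0 htq1 ht0 ht htq

/-- **… hence branch C's per-datum antecedent «∃ ρ qK, QPinned ∧ PilotKummerCompatHull» FAILS** there (any `col`, every pair of realising ideles). [cite: Mochizuki2012, IUTchIII Cor. 3.12 Step (xi-f) p. 184] [cite: DupuyHilado2025, §4.9] [claim: Mochizuki2012, status: disputed] -/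
theorem WRow.not_exists_qPinned_and_hull_frey160412424963707_three_band {l : ℕ} (hl : l.Prime) (hlo : 11 ≤ l) (hhi : l ≤ 159389) (hne : l ≠ 3)
    (T : Cor22.ThetaVolumeDatumAt (ratPoint (((7 ^ 3 * 29 ^ 5 * 151 ^ 2 : ℕ) : ℚ) / (3 ^ 27 * 13 ^ 4 : ℕ))) l) :
    letI := T.instFieldF; letI := T.instNumberFieldF; letI := T.instAlgebraF; letI := T.instFieldK
    letI := T.instNumberFieldK; letI := T.instAlgebraK; letI := T.instFieldFbar; letI := T.instAlgebraFbar
    letI := T.instAlgebraKFbar; letI := T.instIsElliptic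
    ∀ {logv : PadicLogs T.K} (hlog : LogvAnalytic logv) (M : Type) [Field M] [NumberField M]
      (archPk : ∀ (j : (thetaIndex (pilotDataOfK T.D T.K)).Label) (vQ : (thetaIndex (pilotDataOfK T.D T.K)).VQ),
        Set ((logShellsDH (pilotDataOfK T.D T.K) logv).Packet j vQ))
      (archSub : ∀ (j : (thetaIndex (pilotDataOfK T.D T.K)).Label) (v : (thetaIndex (pilotDataOfK T.D T.K)).V),
        Set ((logShellsDH (pilotDataOfK T.D T.K) logv).Packet j ((thetaIndex (pilotDataOfK T.D T.K)).over v)))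
      (Ψ : ℤ → ∀ v : (thetaIndex (pilotDataOfK T.D T.K)).V, v ∈ (thetaIndex (pilotDataOfK T.D T.K)).Vbad →
        Set ((logShellsDH (pilotDataOfK T.D T.K) logv).StarPacket v))
      (act : ℤ → ∀ v : (thetaIndex (pilotDataOfK T.D T.K)).V, v ∈ (thetaIndex (pilotDataOfK T.D T.K)).Vbad →
        (logShellsDH (pilotDataOfK T.D T.K) logv).StarPacket v → Module.End ℚ ((logShellsDH (pilotDataOfK T.D T.K) logv).StarPacket v))
      (Mmod : ℤ → ∀ j : (thetaIndex (pilotDataOfK T.D T.K)).LabelStar, Set ((logShellsDH (pilotDataOfK T.D T.K) logv).GlobalPacket j.1))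
      (region : ℤ → ∀ j : (thetaIndex (pilotDataOfK T.D T.K)).LabelStar, FinDivisor M → ∀ vQ : (thetaIndex (pilotDataOfK T.D T.K)).VQ,
        Set ((logShellsDH (pilotDataOfK T.D T.K) logv).Packet j.1 vQ))
      (n : ℤ) {HT : Type} {LogLink : HT → HT → Type} {IsFull : ∀ {s t : HT}, LogLink s t → Prop}
      (lat : LGPGaussianLogThetaLattice LogLink IsFull)
      {Frd : Type} {IsoF : Frd → Frd → Type} {Ob : Frd → Type} {realify : Frd → Frd} {Strip : Type}
      {IsoS : Strip → Strip → Type} {Mv : ∀ v : (thetaIndex (pilotDataOfK T.D T.K)).V, v ∈ (thetaIndex (pilotDataOfK T.D T.K)).Vbad → Type}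
      [∀ v h, Monoid (Mv v h)]
      (sig : GlobalLGPFrobenioidSignature (thetaIndex (pilotDataOfK T.D T.K)).lstar (thetaIndex (pilotDataOfK T.D T.K)).V
        (· ∈ (thetaIndex (pilotDataOfK T.D T.K)).Vbad) Frd IsoF Ob realify Strip IsoS Mv)
      (split : SplittingMonoids Mv) {ObΔ : Type} {N : ∀ v : (thetaIndex (pilotDataOfK T.D T.K)).V, v ∈ (thetaIndex (pilotDataOfK T.D T.K)).Vbad → Type}
      [∀ v h, Monoid (N v h)] (qData : QPilotData ObΔ N)
      (tq : ∀ (pp : Nat.Primes) (x : (thetaIndex (pilotDataOfK T.D T.K)).Fibre (.inr pp)),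
        haveI : Fact (pp : ℕ).Prime := ⟨pp.2⟩; kOf (pilotDataOfK T.D T.K) pp.1 x)
      (t : ∀ (pp : Nat.Primes) (_ : Fin (pilotDataOfK T.D T.K).lstar) (x : (thetaIndex (pilotDataOfK T.D T.K)).Fibre (.inr pp)),
        haveI : Fact (pp : ℕ).Prime := ⟨pp.2⟩; kOf (pilotDataOfK T.D T.K) pp.1 x)
      (htq0 : ∀ pp x, tq pp x ≠ 0)
      (htq1 : ∀ (pp : Nat.Primes) (x : (thetaIndex (pilotDataOfK T.D T.K)).Fibre (.inr pp)),
        haveI : Fact (pp : ℕ).Prime := ⟨pp.2⟩; placeOf (pilotDataOfK T.D T.K) pp.1 x ∉ (pilotDataOfK T.D T.K).S → ‖tq pp x‖ = 1)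
      (col : ℤ → Column (logShellsDH (pilotDataOfK T.D T.K) logv))
      (_ht0 : ∀ pp i x, t pp i x ≠ 0)
      (_ht : ∀ (pp : Nat.Primes) (i : Fin (pilotDataOfK T.D T.K).lstar) (x : (thetaIndex (pilotDataOfK T.D T.K)).Fibre (.inr pp)),
        haveI : Fact (pp : ℕ).Prime := ⟨pp.2⟩
        Real.log ‖t pp i x‖ = -((pilotDataOfK T.D T.K).thetaPilot i (placeOf (pilotDataOfK T.D T.K) pp.1 x)) *
          logNorm T.K (placeOf (pilotDataOfK T.D T.K) pp.1 x) / localDegree T.K (placeOf (pilotDataOfK T.D T.K) pp.1 x))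
      (_htq : ∀ (pp : Nat.Primes) (x : (thetaIndex (pilotDataOfK T.D T.K)).Fibre (.inr pp)),
        haveI : Fact (pp : ℕ).Prime := ⟨pp.2⟩
        Real.log ‖tq pp x‖ = -((pilotDataOfK T.D T.K).qPilot (placeOf (pilotDataOfK T.D T.K) pp.1 x)) *
          logNorm T.K (placeOf (pilotDataOfK T.D T.K) pp.1 x) / localDegree T.K (placeOf (pilotDataOfK T.D T.K) pp.1 x)),
      ¬ ∃ (ρ : (∀ v : (thetaIndex (pilotDataOfK T.D T.K)).V, v ∈ (thetaIndex (pilotDataOfK T.D T.K)).Vbad →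
              Set ((logShellsDH (pilotDataOfK T.D T.K) logv).StarPacket v)) →
            ∀ (j : (thetaIndex (pilotDataOfK T.D T.K)).Label) (vQ : (thetaIndex (pilotDataOfK T.D T.K)).VQ),
              Set ((logShellsDH (pilotDataOfK T.D T.K) logv).Packet j vQ))
          (qK : ∀ v : (thetaIndex (pilotDataOfK T.D T.K)).V, v ∈ (thetaIndex (pilotDataOfK T.D T.K)).Vbad →
            Set ((logShellsDH (pilotDataOfK T.D T.K) logv).StarPacket v)),
          QPinned ({ toSituation := situationPrVol (pilotDataOfK T.D T.K) hlog M archPk archSub Ψ act Mmod region, col := col } :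
              LatticeSituation (thetaIndex (pilotDataOfK T.D T.K)))
            (settingPrVolSharp (pilotDataOfK T.D T.K) hlog M archPk archSub Ψ act Mmod region n lat sig split qData tq t htq0 htq1) ρ qK ∧
          PilotKummerCompatHull ({ toSituation := situationPrVol (pilotDataOfK T.D T.K) hlog M archPk archSub Ψ act Mmod region, col := col } :
              LatticeSituation (thetaIndex (pilotDataOfK T.D T.K)))
            (settingPrVolSharp (pilotDataOfK T.D T.K) hlog M archPk archSub Ψ act Mmod region n lat sig split qData tq t htq0 htq1) ρ qK := by
  obtain ⟨hhi', hodd, hpe, hi⟩ := RefBand.frey160412424963707_three_aux hl hlo hhi hne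
  obtain ⟨a₀, h1, h2, h3⟩ := RefBand.cells_frey160412424963707_three_band hlo hhi' hodd (i := (l - 1) / 2 - 1) (by omega)
  have hP : 10 * l * (7 ^ 3 * 29 ^ 5 * 151 ^ 2 * (2 ^ 4 * 5 ^ 16 * 97 * 919) * (3 ^ 27 * 13 ^ 4)).factorization ((⟨3, by norm_num⟩ : Nat.Primes) : ℕ) = l * 270 := by
    rw [RefBand.frey160412424963707_three_fac]; ring
  intro logv hlog M _ _ archPk archSub Ψ act Mmod region n HT LogLink IsFull lat Frd IsoF Ob realify Strip IsoS Mv _ sig split ObΔ N _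
    qData tq t htq0 htq1 col ht0 ht htq
  exact WRow.not_exists_qPinned_and_hull_triple_of_not_hullCell isABCTriple_frey160412424963707 T ⟨3, by norm_num⟩ (by norm_num) (show (3 : ℕ) ≠ l by omega)
    (by norm_num) (e₀ := 10 * l) (P := 270) (i := (l - 1) / 2 - 1) (a₀ := a₀) hpe (GenuineK.absRamificationIdx_kOf_frey160412424963707_three T (by omega)) hP hi h1 h2 h3
    hlog M archPk archSub Ψ act Mmod region n lat sig split qData tq t htq0 htq1 col ht0 ht htq

end Summit.ABC.IUTFork.Conditional

end
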